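import Summits.Ventures.HodgeRepro.Night1TwistedTraceRank

/-!
# The `ℚ`-form of an orbit piece, made explicit: the rational Pohlmann classes are in bijection with the
image of the sign-twisted trace, a `ℚ`-space of dimension the orbit length

Blind re-derivation cell `pub-hodge-repro`, seat `night-1` (gen 6).  Imports night-1's `Night1TwistedTraceRank`
(`ratPohlmann_eq_zero_iff`, `twistedTrace_eq_twistedLin`, `finrank_range_twistedLin_stabSign`).  Namespace
`HodgeRepro.RouteC`.

* `ratPohlmann_sub` — `ratPohlmann` is additive, hence respects differences;
* **`ratPohlmann_eq_iff`** — `f_Δ^*(ratWeil f) = f_Δ^*(ratWeil f') ⟺ Tr^{sgn} f = Tr^{sgn} f'`: the rational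
  Pohlmann class of `f` depends exactly on its sign-twisted trace;
* **`ratPohlmannOfTrace`** — the well-defined map `range Tr^{sgn} → range ratPohlmann`, `Tr^{sgn} f ↦ ratPohlmann f`,
  and **`ratPohlmannEquiv`** — it is a BIJECTION (`Equiv.ofBijective`): the set of rational Pohlmann classes of
  the orbit piece `f_Δ^*(W_F(A_Δ)) ⊗ ℂ` is in bijection with `range Tr^{sgn}`, a `ℚ`-subspace of `K` of
  dimension `|G • Δ|` (`finrank_range_twistedLin_stabSign`) — the `ℚ`-form of the orbit piece, of the right
  dimension (`finrank_map_andrePull_weilSpaceProd`), without a `ℚ`-module structure on `⋀^{2p} ℂ^X`.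

Nothing geometric is built.  Nothing here says anything about the status of the Hodge conjecture for CM
abelian varieties, which is NOT proved.
-/

set_option autoImplicit false

open Finset Module
open scoped Pointwise Classical

namespace HodgeRepro.RouteC

open CMHodge CMHodgeOn

variable (K : Type*) [Field K] [NumberField K] [IsGalois ℚ K] (φ₀ : K →+* ℂ)
variable {X : Type*} [MulAction (K ≃ₐ[ℚ] K) X] [Fintype X] [DecidableEq X]

omit [IsGalois ℚ K] [Fintype X] in
/-- `ratPohlmann` respects differences. -/
theorem ratPohlmann_sub {p : ℕ} (Δ : Finset X) (e : Fin (2 * p) ≃ ↥Δ) (f f' : K) :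
    ratPohlmann K φ₀ Δ e (f - f') = ratPohlmann K φ₀ Δ e f - ratPohlmann K φ₀ Δ e f' := by
  unfold ratPohlmann
  rw [← Finset.sum_sub_distrib]
  refine Finset.sum_congr rfl fun g _ => ?_
  rw [map_sub, map_sub]
  exact sub_smul (φ₀ (g f)) (φ₀ (g f')) (coordWedgeOn (2 * p) (deltaEnum Δ e g))

omit [IsGalois ℚ K] [Fintype X] in
/-- `twistedTrace` respects differences. -/
theorem twistedTrace_sub {n : ℕ} {Δ : Finset X} (e : Fin n ≃ ↥Δ) (f f' : K) :
    twistedTrace K e (f - f') = twistedTrace K e f - twistedTrace K e f' := by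
  rw [twistedTrace_eq_twistedLin, twistedTrace_eq_twistedLin, twistedTrace_eq_twistedLin, map_sub]

omit [IsGalois ℚ K] [Fintype X] in
/-- **The rational Pohlmann class of `f` is determined by its sign-twisted trace, and conversely.** -/
theorem ratPohlmann_eq_iff {p : ℕ} (Δ : Finset X) (e : Fin (2 * p) ≃ ↥Δ) (f f' : K) :
    ratPohlmann K φ₀ Δ e f = ratPohlmann K φ₀ Δ e f' ↔ twistedTrace K e f = twistedTrace K e f' := by
  rw [← sub_eq_zero, ← ratPohlmann_sub, ratPohlmann_eq_zero_iff, twistedTrace_sub, sub_eq_zero]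

omit [IsGalois ℚ K] [Fintype X] in
/-- The map `range Tr^{sgn} → range ratPohlmann`, `Tr^{sgn} f ↦ ratPohlmann f` (well defined by
`ratPohlmann_eq_iff`). -/
noncomputable def ratPohlmannOfTrace {p : ℕ} (Δ : Finset X) (e : Fin (2 * p) ≃ ↥Δ)
    (t : Set.range (twistedTrace K e)) : Set.range (ratPohlmann K φ₀ Δ e) :=
  ⟨ratPohlmann K φ₀ Δ e t.2.choose, t.2.choose, rfl⟩

omit [IsGalois ℚ K] [Fintype X] in
/-- The map, on `Tr^{sgn} f`: it is `ratPohlmann f`. -/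
theorem coe_ratPohlmannOfTrace {p : ℕ} (Δ : Finset X) (e : Fin (2 * p) ≃ ↥Δ) (f : K) :
    (ratPohlmannOfTrace K φ₀ Δ e ⟨twistedTrace K e f, f, rfl⟩ : ⋀[ℂ]^(2 * p) (X → ℂ)) =
      ratPohlmann K φ₀ Δ e f := by
  show ratPohlmann K φ₀ Δ e (Exists.choose _) = _
  rw [ratPohlmann_eq_iff]
  exact Exists.choose_spec (⟨f, rfl⟩ : ∃ f', twistedTrace K e f' = twistedTrace K e f)

omit [IsGalois ℚ K] [Fintype X] in
/-- **The rational Pohlmann classes are in bijection with the image of the sign-twisted trace.** -/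
theorem ratPohlmannOfTrace_bijective {p : ℕ} (Δ : Finset X) (e : Fin (2 * p) ≃ ↥Δ) :
    Function.Bijective (ratPohlmannOfTrace K φ₀ Δ e) := by
  constructor
  · rintro ⟨_, f, rfl⟩ ⟨_, f', rfl⟩ h
    have h' := congrArg Subtype.val h
    rw [coe_ratPohlmannOfTrace, coe_ratPohlmannOfTrace, ratPohlmann_eq_iff] at h'
    exact Subtype.ext h'
  · rintro ⟨_, f, rfl⟩
    exact ⟨⟨twistedTrace K e f, f, rfl⟩, Subtype.ext (coe_ratPohlmannOfTrace K φ₀ Δ e f)⟩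

omit [IsGalois ℚ K] [Fintype X] in
/-- **The `ℚ`-form of the orbit piece, explicitly**: `range Tr^{sgn} ≃ {rational Pohlmann classes of Δ}`. -/
noncomputable def ratPohlmannEquiv {p : ℕ} (Δ : Finset X) (e : Fin (2 * p) ≃ ↥Δ) :
    Set.range (twistedTrace K e) ≃ Set.range (ratPohlmann K φ₀ Δ e) :=
  Equiv.ofBijective _ (ratPohlmannOfTrace_bijective K φ₀ Δ e)

omit [IsGalois ℚ K] [Fintype X] in
/-- The `ℚ`-dimension of the source of that bijection is the orbit length: `range Tr^{sgn}` is the range of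
the `ℚ`-linear `twistedLin` at `χ = stabSign e`, of `finrank` `|G • Δ|`. -/
theorem range_twistedTrace_eq {n : ℕ} (Δ : Finset X) (e : Fin n ≃ ↥Δ) :
    Set.range (twistedTrace K e) =
      (LinearMap.range (twistedLin K (MulAction.stabilizer (K ≃ₐ[ℚ] K) Δ) (stabSign e)) : Set K) := by
  ext t
  simp only [Set.mem_range, SetLike.mem_coe, LinearMap.mem_range, twistedTrace_eq_twistedLin]

end HodgeRepro.RouteC
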